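import Literature.Combinatorics.Additive.RelativeSzemerediProofs
import Literature.Combinatorics.Additive.RelativeSzemerediDenseModel
import Literature.Combinatorics.Additive.RelativeSzemerediCounting
import Literature.NumberTheory.Sieve.ParityWave0GreenTaoHolds
import HarnessLib

/-!
# Conlon–Fox–Zhao, Theorem 4.3 — the relative Szemerédi theorem (discharge under its own name)

Topic `Literature/Combinatorics/Additive`. The named fact `CFZ.RelativeSzemeredi`
(`RelativeSzemeredi.lean`; D. Conlon, J. Fox, Y. Zhao, *The Green–Tao theorem: an exposition*,
EMS Surv. Math. Sci. 1 (2014), Theorem 4.3) has been proved in the tree in assembled form —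
`CFZ.relativeSzemeredi_of` (`RelativeSzemerediProofs.lean`) from the dense model theorem
(`CFZ.denseModel_holds`), the relative counting lemma (`CFZ.relativeCounting_holds`) and Szemerédi's
theorem in expectation form (`GreenTao2008.SzemerediExpectation_holds`), and it is consumed that way
by `GreenTao2008.RelativeSzemeredi_holds` (`GreenTao2008RelativeSzemerediProofs.lean`) — but no
theorem of type `CFZ.RelativeSzemeredi` was recorded. This leaf records the discharge under the
fact's own name; no new definitions, no new named facts.
-/

namespace Literature.Combinatorics.Additive

/-- **Conlon–Fox–Zhao 2014, Theorem 4.3 (relative Szemerédi theorem), discharged**: the named fact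
`CFZ.RelativeSzemeredi` holds, by `CFZ.relativeSzemeredi_of` applied to the tree's discharges of
its three inputs (Szemerédi in expectation form, the dense model theorem, the relative counting
lemma). Not to be confused with `GreenTao2008.RelativeSzemeredi_holds` (Green–Tao 2008 Thm. 3.5,
pseudorandom-measure form), which is deduced from this one by `RelativeSzemeredi_of_cfz`.
[cite: ConlonFoxZhao2014, Theorem 4.3] -/
theorem CFZ.RelativeSzemeredi_holds : CFZ.RelativeSzemeredi :=
  CFZ.relativeSzemeredi_of Literature.NumberTheory.Sieve.GreenTao2008.SzemerediExpectation_holds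
    CFZ.denseModel_holds CFZ.relativeCounting_holds

end Literature.Combinatorics.Additive
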